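import Mathlib.Analysis.InnerProductSpace.Projection.Basic
import Literature.NumberTheory.Automorphic.StrongMultiplicityOneSphericalProofs
import Literature.NumberTheory.Automorphic.SatakeParameterTrivialBound
import Literature.NumberTheory.Automorphic.GLnCuspidalSpectrum
import HarnessLib

/-!
# A cuspidal representation unramified outside `S` has a level supported on `S`

Topic `NumberTheory/Automorphic`; namespace `Literature.NumberTheory.Automorphic`. Theorems only
(no definition, no named fact).

Let `Π ≤ L²_cusp(GL_n(K) A_G \ GL_n(𝔸_K))` be a cuspidal automorphic representation and `S` a
set of finite places such that `Π` is unramified at every `v ∉ S` (`IsUnramifiedAt`: a non-zero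
`K(𝔫_v)`-fixed Hecke eigenvector for SOME level `𝔫_v` prime to `v`). Then `Π` has a non-zero vector
fixed by a principal congruence subgroup `K(𝔫)`, `𝔫 ≠ 0`, all of whose prime divisors lie in `S`
(`CuspidalAutomorphicRepGL.exists_fixedVectors_level_supportedIn`). In print this is read off the
restricted tensor product `Π ≅ ⊗'_v Π_v` (Flath (1979), Thm. 3; Borel–Jacquet (1979), §4.6:
`Π^{K} = ⊗_v Π_v^{K_v}` for `K = ∏ K_v`), which is how Jacquet–Piatetski-Shapiro–Shalika and Cogdell
((2004), §4.1) choose pure tensors `φ = ⊗ φ_v` spherical outside the ramified set. Here it is proved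
on the `L²`-model without the tensor product theorem:

* `starProjection_fixedVectors_toContRep_comm` — the orthogonal projection `p_w` of `Π` onto the
  vectors fixed by `ι_w(GL_n(𝒪_w))` commutes with `Π(c)` for every `c` of trivial `w`-component
  (unitarity);
* `exists_level_of_level_pow_mul` — if `Π` is unramified at `w` then `p_w ≠ 0`, and for every
  `x ≠ 0` some `p_w(Π(ι_w g_w) x)`, `g_w ∈ GL_n(K_w)`, is non-zero: otherwise
  `p_w(Π(g) x) = Π(c) p_w(Π(ι_w g_w) x) = 0` for all `g = c ι_w(g_w)`, and the closed invariant
  subspace `{y | ∀ g, p_w(Π(g) y) = 0} ∋ x` would be all of `Π` (topological irreducibility); for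
  `x` of level `K(𝔭_w^e 𝔪')`, `w ∤ 𝔪'`, that vector has level `K(𝔪')`
  (`K(𝔪') = ι_w(GL_n(𝒪_w)) · K(𝔭_w^e 𝔪')`);
* `exists_fixedVectors_level_supportedIn` — induction on the number of primes of the level
  outside `S` (`WfDvdMonoid.max_power_factor`).

## References

* D. Flath, *Decomposition of representations into tensor products*, Corvallis 1979, part 1,
  Thm. 3 [FlathCorvallis1979].
* A. Borel, H. Jacquet, *Automorphic forms and automorphic representations*, Corvallis 1979,
  part 1, §4.6 [BorelJacquetCorvallis1979].
* J. W. Cogdell, *Analytic theory of L-functions for GL_n* (2004), §4.1 [CogdellAnalyticTheory2004].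
-/

noncomputable section

open MeasureTheory NumberField IsDedekindDomain
open scoped MatrixGroups

namespace Literature.NumberTheory.Automorphic

variable {n : ℕ} {K : Type} [Field K] [NumberField K]
  {μ : Measure (AdelicGroupData.gl n K).automorphicQuotient}
  [(AdelicGroupData.gl n K).IsAutomorphicMeasure μ]

/-! ### The orthogonal projection onto the vectors fixed by a subgroup -/

section Projection

variable (W : ContRepresentation.ClosedSubrep ((AdelicGroupData.gl n K).rightRegular μ))
  (H : Subgroup (GL (Fin n) (AdeleRing (𝓞 K) K)))

/-- `Π(a b) x = Π(a) (Π(b) x)` on a closed subrepresentation. [folklore] -/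
theorem ClosedSubrep.toContRep_mul_apply' (a b : GL (Fin n) (AdeleRing (𝓞 K) K)) (x : W.toSubmodule) :
    W.toContRep (a * b) x = W.toContRep a (W.toContRep b x) :=
  (DFunLike.congr_fun (map_mul W.toContRep a b) x).trans rfl

/-- The fixed vectors of a subgroup form a closed subspace. [folklore] -/
theorem isClosed_fixedVectors : IsClosed ((W.fixedVectors H : Submodule ℂ W.toSubmodule) : Set W.toSubmodule) := by
  have hset : ((W.fixedVectors H : Submodule ℂ W.toSubmodule) : Set W.toSubmodule) =
      ⋂ h ∈ H, {f : W.toSubmodule | W.toContRep h f = f} := by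
    ext f
    simp only [SetLike.mem_coe, ContRepresentation.ClosedSubrep.mem_fixedVectors, Set.mem_iInter,
      Set.mem_setOf_eq]
    exact Iff.rfl
  rw [hset]
  exact isClosed_biInter fun h _ => isClosed_eq (W.toContRep h).continuous continuous_id

variable {W H}

/-- **`Π(c)` preserves the `H`-fixed vectors for `c` centralising `H`.** [folklore] -/
theorem toContRep_mem_fixedVectors_of_comm {c : GL (Fin n) (AdeleRing (𝓞 K) K)}
    (hc : ∀ h ∈ H, c * h = h * c) {f : W.toSubmodule} (hf : f ∈ W.fixedVectors H) :
    W.toContRep c f ∈ W.fixedVectors H := by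
  rw [ContRepresentation.ClosedSubrep.mem_fixedVectors] at hf ⊢
  intro h hh
  rw [← ClosedSubrep.toContRep_mul_apply', ← hc h hh, ClosedSubrep.toContRep_mul_apply', hf h hh]

/-- **The orthogonal projection onto the `H`-fixed vectors commutes with `Π(c)` for `c`
centralising `H`** (`Π(c)` is unitary and preserves the fixed space and its orthogonal
complement). [folklore] -/
theorem starProjection_fixedVectors_toContRep_comm [(W.fixedVectors H).HasOrthogonalProjection]
    {c : GL (Fin n) (AdeleRing (𝓞 K) K)} (hc : ∀ h ∈ H, c * h = h * c) (x : W.toSubmodule) :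
    (W.fixedVectors H).starProjection (W.toContRep c x) = W.toContRep c ((W.fixedVectors H).starProjection x) := by
  have hcinv : ∀ h ∈ H, c⁻¹ * h = h * c⁻¹ := fun h hh => by
    have := hc h hh
    calc c⁻¹ * h = c⁻¹ * (h * c) * c⁻¹ := by group
      _ = c⁻¹ * (c * h) * c⁻¹ := by rw [this]
      _ = h * c⁻¹ := by group
  refine Submodule.eq_starProjection_of_mem_orthogonal
    (toContRep_mem_fixedVectors_of_comm hc (Submodule.starProjection_apply_mem _ x)) ?_
  rw [← map_sub]
  have hz := Submodule.sub_starProjection_mem_orthogonal (K := W.fixedVectors H) x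
  set z : W.toSubmodule := x - (W.fixedVectors H).starProjection x with hzdef
  rw [Submodule.mem_orthogonal] at hz ⊢
  intro u hu
  -- `Π(c)` as a linear isometry: `⟪u, Π(c) z⟫ = ⟪Π(c⁻¹) u, z⟫ = 0`
  let U : W.toSubmodule →ₗᵢ[ℂ] W.toSubmodule :=
    { toLinearMap := (W.toContRep c : W.toSubmodule →L[ℂ] W.toSubmodule).toLinearMap
      norm_map' := norm_toContRep_apply W c }
  have h1 : W.toContRep c (W.toContRep c⁻¹ u) = u := by
    have h := ClosedSubrep.toContRep_mul_apply' W c c⁻¹ u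
    rw [mul_inv_cancel] at h
    change W.toContRep (1 : (AdelicGroupData.gl n K).Adelic) u = _ at h
    rw [map_one] at h
    exact h.symm
  have h2 : inner ℂ u (W.toContRep c z) = inner ℂ (W.toContRep c⁻¹ u) z := by
    conv_lhs => rw [← h1]
    exact U.inner_map_map (W.toContRep c⁻¹ u) z
  rw [h2]
  exact hz _ (toContRep_mem_fixedVectors_of_comm hcinv hu)

end Projection

/-! ### One place: the projection onto the `GL_n(𝒪_w)`-fixed vectors -/

section OnePlace

variable (w : HeightOneSpectrum (𝓞 K))

/-- Elements of trivial `w`-component centralise `ι_w(GL_n(K_w))`. [folklore] -/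
theorem comm_of_toLocal_eq_one {c : GL (Fin n) (AdeleRing (𝓞 K) K)}
    (hc : Matrix.GeneralLinearGroup.map (AdelicGroupData.adeleEval K w) c = 1) :
    ∀ h ∈ (valuedCongruenceSubgroup (Fin n) (1 : WithZero (Multiplicative ℤ))).map (GLn.ofLocal n K w),
      c * h = h * c := by
  rintro _ ⟨t, -, rfl⟩
  exact (GLn.ofLocal_mul_eq_mul_ofLocal_of_toLocal_eq_one t hc).symm

/-- `g ι_w(g_w)⁻¹` has trivial `w`-component. [folklore] -/
theorem map_adeleEval_mul_ofLocal_inv (g : GL (Fin n) (AdeleRing (𝓞 K) K)) :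
    Matrix.GeneralLinearGroup.map (AdelicGroupData.adeleEval K w)
        (g * (GLn.ofLocal n K w (Matrix.GeneralLinearGroup.map (AdelicGroupData.adeleEval K w) g))⁻¹) = 1 := by
  rw [map_mul, map_inv, GLn.map_adeleEval_ofLocal, mul_inv_cancel]

/-- **Peeling the `w`-component.** If `k ∈ K(𝔪')` with `𝔪' ≠ 0` prime to `w`, then
`k · ι_w(k_w)⁻¹ ∈ K(𝔭_w^e 𝔪')` for every `e`: it is `1` at `w` and equals `k` at `v ≠ w`, where
`|𝔭_w^e 𝔪'|_v = |𝔪'|_v` (a local copy of the lemma of `GodementJacquetRankOneEntire`, whose import is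
avoided; Bump (1997), §3.3: `K(𝔪') = GL_n(𝒪_w) · K(𝔪')^{(w)}`). [folklore] -/
theorem mul_ofLocal_inv_mem_principalCongruenceLevel_pow_mul {𝔪' : Ideal (𝓞 K)} (h𝔪' : 𝔪' ≠ 0)
    (hw𝔪' : ¬ w.asIdeal ∣ 𝔪') (e : ℕ)
    {k : GL (Fin n) (AdeleRing (𝓞 K) K)} (hk : k ∈ principalCongruenceLevel n K 𝔪') :
    k * (GLn.ofLocal n K w (Matrix.GeneralLinearGroup.map (AdelicGroupData.adeleEval K w) k))⁻¹ ∈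
      principalCongruenceLevel n K (w.asIdeal ^ e * 𝔪') := by
  set s : GL (Fin n) (AdeleRing (𝓞 K) K) :=
    GLn.ofLocal n K w (Matrix.GeneralLinearGroup.map (AdelicGroupData.adeleEval K w) k) with hs
  obtain ⟨hkint, hkv⟩ := mem_principalCongruenceLevel_iff.mp hk
  have hkw : Matrix.GeneralLinearGroup.map (AdelicGroupData.adeleEval K w) k ∈
      valuedCongruenceSubgroup (Fin n) (1 : WithZero (Multiplicative ℤ)) :=
    toLocal_mem_valuedCongruenceSubgroup_one hkint w
  have hsK : s ∈ principalCongruenceLevel n K 𝔪' :=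
    isMaximalAt_principalCongruenceLevel n K w h𝔪' hw𝔪' ⟨_, hkw, rfl⟩
  rw [mem_principalCongruenceLevel_iff]
  refine ⟨(glIntegralLevel n K).mul_mem hkint
    ((glIntegralLevel n K).inv_mem (principalCongruenceLevel_le n K 𝔪' hsK)), fun v => ?_⟩
  show Matrix.GeneralLinearGroup.map (AdelicGroupData.adeleEval K v) (k * s⁻¹) ∈
    valuedCongruenceSubgroup (Fin n) (idealRadius K v (w.asIdeal ^ e * 𝔪'))
  rw [map_mul, map_inv]
  by_cases hv : v = w
  · subst hv
    rw [hs, GLn.map_adeleEval_ofLocal, mul_inv_cancel]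
    exact one_mem _
  · have h1 : Matrix.GeneralLinearGroup.map (AdelicGroupData.adeleEval K v) s = 1 :=
      GLn.toLocal_ofLocal_of_ne hv _
    rw [h1, inv_one, mul_one, idealRadius_pow_mul_of_ne K hv e h𝔪']
    exact hkv v

variable {w}

/-- **If `Π` is unramified at `w`, it has a non-zero `ι_w(GL_n(𝒪_w))`-fixed vector.** [folklore] -/
theorem exists_mem_fixedVectors_ofLocal_ne_zero (P : CuspidalAutomorphicRepGL n K μ) (hw : IsUnramifiedAt P.1 w) :
    ∃ f ∈ P.1.fixedVectors ((valuedCongruenceSubgroup (Fin n) (1 : WithZero (Multiplicative ℤ))).map (GLn.ofLocal n K w)),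
      f ≠ 0 := by
  obtain ⟨𝔫, h𝔫, hw𝔫, f, hf, hf0⟩ := hw.exists_mem_fixedVectors
  exact ⟨f, P.1.fixedVectors_antitone (isMaximalAt_principalCongruenceLevel n K w h𝔫 hw𝔫) hf, hf0⟩

/-- **One step of the descent.** Let `Π` be cuspidal and unramified at `w`, and `x ≠ 0` a vector of
level `K(𝔭_w^e 𝔪')` with `w ∤ 𝔪' ≠ 0`. Then `Π` has a non-zero vector of level `K(𝔪')`, namely
`p_w(Π(ι_w g_w) x)` for a suitable `g_w ∈ GL_n(K_w)`, `p_w` the orthogonal projection onto the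
`ι_w(GL_n(𝒪_w))`-fixed vectors: some such projection is non-zero (otherwise `p_w(Π(g) x) = 0` for all
`g = c ι_w(g_w)`, `c` centralising `ι_w(·)`, and the closed invariant subspace of such vectors, which
contains `x ≠ 0`, would be all of `Π` by topological irreducibility, forcing `p_w = 0` — but `Π` has
non-zero `GL_n(𝒪_w)`-fixed vectors); and it is fixed by `K(𝔪') = ι_w(GL_n(𝒪_w)) · K(𝔭_w^e 𝔪')`, the
second factor centralising `ι_w(·)` and fixing `x`. [folklore] -/
theorem exists_level_of_level_pow_mul (P : CuspidalAutomorphicRepGL n K μ) (hw : IsUnramifiedAt P.1 w)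
    {𝔪' : Ideal (𝓞 K)} (h𝔪' : 𝔪' ≠ 0) (hw𝔪' : ¬ w.asIdeal ∣ 𝔪') (e : ℕ)
    {x : P.1.toSubmodule} (hx0 : x ≠ 0)
    (hx : ∀ u ∈ principalCongruenceLevel n K (w.asIdeal ^ e * 𝔪'), P.1.toContRep u x = x) :
    ∃ y : P.1.toSubmodule, y ≠ 0 ∧ ∀ u ∈ principalCongruenceLevel n K 𝔪', P.1.toContRep u y = y := by
  -- the projection onto the `ι_w(GL_n(𝒪_w))`-fixed vectors
  let H : Subgroup (GL (Fin n) (AdeleRing (𝓞 K) K)) :=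
    (valuedCongruenceSubgroup (Fin n) (1 : WithZero (Multiplicative ℤ))).map (GLn.ofLocal n K w)
  let F : Submodule ℂ P.1.toSubmodule := P.1.fixedVectors H
  haveI : CompleteSpace F := (isClosed_fixedVectors P.1 H).completeSpace_coe
  haveI : F.HasOrthogonalProjection := Submodule.HasOrthogonalProjection.ofCompleteSpace F
  let p : P.1.toSubmodule →L[ℂ] P.1.toSubmodule := F.starProjection
  have hcomm : ∀ {c : GL (Fin n) (AdeleRing (𝓞 K) K)},
      Matrix.GeneralLinearGroup.map (AdelicGroupData.adeleEval K w) c = 1 → ∀ z : P.1.toSubmodule,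
        p (P.1.toContRep c z) = P.1.toContRep c (p z) := fun hc z =>
    starProjection_fixedVectors_toContRep_comm (comm_of_toLocal_eq_one w hc) z
  -- (1) some translate at `w` has a non-zero projection
  have hex : ∃ g : GL (Fin n) (w.adicCompletion K), p (P.1.toContRep (GLn.ofLocal n K w g) x) ≠ 0 := by
    by_contra hall
    push Not at hall
    have hall' : ∀ g : GL (Fin n) (AdeleRing (𝓞 K) K), p (P.1.toContRep g x) = 0 := by
      intro g
      set gw : GL (Fin n) (AdeleRing (𝓞 K) K) :=
        GLn.ofLocal n K w (Matrix.GeneralLinearGroup.map (AdelicGroupData.adeleEval K w) g) with hgw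
      have hg : g = g * gw⁻¹ * gw := by rw [inv_mul_cancel_right]
      rw [hg, ClosedSubrep.toContRep_mul_apply', hcomm (map_adeleEval_mul_ofLocal_inv w g), hgw, hall, map_zero]
    -- the closed invariant subspace `{y | ∀ g, p (Π(g) y) = 0}`
    let Z : ContRepresentation.ClosedSubrep P.1.toContRep :=
      { toSubmodule :=
          { carrier := {y | ∀ g : GL (Fin n) (AdeleRing (𝓞 K) K), p (P.1.toContRep g y) = 0}
            add_mem' := fun {a b} ha hb g => by
              simp only [Set.mem_setOf_eq] at ha hb ⊢
              rw [map_add, map_add, ha g, hb g, add_zero]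
            zero_mem' := fun g => by simp only [map_zero]
            smul_mem' := fun c a ha g => by
              simp only [Set.mem_setOf_eq] at ha ⊢
              rw [map_smul, map_smul, ha g, smul_zero] }
        apply_mem_toSubmodule := fun g y hy g' => by
          change p (P.1.toContRep g' (P.1.toContRep g y)) = 0
          have h := hy (g' * (show GL (Fin n) (AdeleRing (𝓞 K) K) from g))
          rw [ClosedSubrep.toContRep_mul_apply'] at h
          exact h
        isClosed' := by
          change IsClosed {y : P.1.toSubmodule | ∀ g : GL (Fin n) (AdeleRing (𝓞 K) K), p (P.1.toContRep g y) = 0}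
          have hset : {y : P.1.toSubmodule | ∀ g : GL (Fin n) (AdeleRing (𝓞 K) K), p (P.1.toContRep g y) = 0} =
              ⋂ g : GL (Fin n) (AdeleRing (𝓞 K) K), {y | p (P.1.toContRep g y) = 0} := by
            ext y; simp only [Set.mem_setOf_eq, Set.mem_iInter]
          rw [hset]
          exact isClosed_iInter fun g => isClosed_eq (p.continuous.comp (P.1.toContRep g).continuous) continuous_const }
    have hxZ : x ∈ Z := hall'
    rcases ((ContRepresentation.isTopIrreducible_iff _).1 P.isTopIrreducible).2 Z with hZ | hZ
    · rw [hZ, ContRepresentation.ClosedSubrep.mem_bot] at hxZ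
      exact hx0 hxZ
    · obtain ⟨f, hf, hf0⟩ := exists_mem_fixedVectors_ofLocal_ne_zero P hw
      have hfF : f ∈ F := hf
      have hfZ : f ∈ Z := by rw [hZ]; exact ContRepresentation.ClosedSubrep.mem_top f
      have h1 : p (P.1.toContRep 1 f) = 0 := hfZ 1
      change p (P.1.toContRep (1 : (AdelicGroupData.gl n K).Adelic) f) = 0 at h1
      rw [map_one] at h1
      change p f = 0 at h1
      have h2 : p f = f := (Submodule.starProjection_eq_self_iff (K := F)).2 hfF
      rw [h2] at h1
      exact hf0 h1
  -- (2) that vector has level `K(𝔪')`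
  obtain ⟨g, hg⟩ := hex
  refine ⟨p (P.1.toContRep (GLn.ofLocal n K w g) x), hg, fun u hu => ?_⟩
  set uw := Matrix.GeneralLinearGroup.map (AdelicGroupData.adeleEval K w) u with huw
  set ιuw : GL (Fin n) (AdeleRing (𝓞 K) K) := GLn.ofLocal n K w uw with hιuw
  set c : GL (Fin n) (AdeleRing (𝓞 K) K) := u * ιuw⁻¹ with hc
  have hcK : c ∈ principalCongruenceLevel n K (w.asIdeal ^ e * 𝔪') :=
    mul_ofLocal_inv_mem_principalCongruenceLevel_pow_mul w h𝔪' hw𝔪' e hu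
  have hc1 : Matrix.GeneralLinearGroup.map (AdelicGroupData.adeleEval K w) c = 1 := map_adeleEval_mul_ofLocal_inv w u
  have huwK : uw ∈ valuedCongruenceSubgroup (Fin n) (1 : WithZero (Multiplicative ℤ)) :=
    toLocal_mem_valuedCongruenceSubgroup_one (principalCongruenceLevel_le n K _ hu) w
  have hιH : ιuw ∈ H := ⟨uw, huwK, rfl⟩
  have hu' : u = c * ιuw := by rw [hc, inv_mul_cancel_right]
  have hyH := Submodule.starProjection_apply_mem F (P.1.toContRep (GLn.ofLocal n K w g) x)
  rw [ContRepresentation.ClosedSubrep.mem_fixedVectors] at hyH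
  change P.1.toContRep u (p _) = p _
  rw [hu', ClosedSubrep.toContRep_mul_apply', hyH _ hιH, ← hcomm hc1]
  set ιg : GL (Fin n) (AdeleRing (𝓞 K) K) := GLn.ofLocal n K w g with hιg
  have hcg : c * ιg = ιg * c := (GLn.ofLocal_mul_eq_mul_ofLocal_of_toLocal_eq_one g hc1).symm
  have h3 := ClosedSubrep.toContRep_mul_apply' P.1 c ιg x
  rw [hcg, ClosedSubrep.toContRep_mul_apply', hx c hcK] at h3
  rw [← h3]

end OnePlace

/-! ### Induction on the primes of the level outside `S` -/

section Level

/-- **A cuspidal representation unramified outside `S` has a non-zero vector of a level supported on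
`S`** (main theorem). For every cuspidal automorphic representation `Π` of `GL_n(𝔸_K)` and every set
`S` of finite places off which `Π` is unramified there are `𝔫 ≠ 0`, all of whose prime divisors lie
in `S`, and `0 ≠ f ∈ Π` fixed by the principal congruence subgroup `K(𝔫)` (Flath (1979), Thm. 3 with
Borel–Jacquet (1979), §4.6: `Π^{K} = ⊗ Π_v^{K_v}`; here from irreducibility and unitarity on the
`L²`-model, by induction on the number of primes of the level outside `S`, each removed by
`exists_level_of_level_pow_mul` after writing the level as `𝔭_w^e 𝔪'`, `w ∤ 𝔪'`).
[cite: FlathCorvallis1979, Thm. 3] [cite: BorelJacquetCorvallis1979, §4.6] -/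
theorem CuspidalAutomorphicRepGL.exists_fixedVectors_level_supportedIn (P : CuspidalAutomorphicRepGL n K μ)
    (S : Set (HeightOneSpectrum (𝓞 K))) (hS : ∀ v ∉ S, IsUnramifiedAt P.1 v) :
    ∃ 𝔫 : Ideal (𝓞 K), 𝔫 ≠ 0 ∧ (∀ v : HeightOneSpectrum (𝓞 K), v.asIdeal ∣ 𝔫 → v ∈ S) ∧
      ∃ f : P.1.toSubmodule, f ≠ 0 ∧ ∀ u ∈ principalCongruenceLevel n K 𝔫, P.1.toContRep u f = f := by
  classical
  -- induction on the number of prime divisors of the level outside `S`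
  suffices h : ∀ (N : ℕ) (𝔪 : Ideal (𝓞 K)) (h𝔪 : 𝔪 ≠ 0),
      ((Ideal.finite_factors h𝔪).toFinset.filter (· ∉ S)).card ≤ N →
      ∀ x : P.1.toSubmodule, x ≠ 0 → (∀ u ∈ principalCongruenceLevel n K 𝔪, P.1.toContRep u x = x) →
      ∃ 𝔫 : Ideal (𝓞 K), 𝔫 ≠ 0 ∧ (∀ v : HeightOneSpectrum (𝓞 K), v.asIdeal ∣ 𝔫 → v ∈ S) ∧
        ∃ f : P.1.toSubmodule, f ≠ 0 ∧ ∀ u ∈ principalCongruenceLevel n K 𝔫, P.1.toContRep u f = f by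
    obtain ⟨𝔪, h𝔪, hne⟩ := exists_fixedVectors_principalCongruenceLevel_ne_bot_holds (n := n) (K := K) (μ := μ) P
    obtain ⟨x, hx, hx0⟩ := (Submodule.ne_bot_iff _).mp hne
    rw [ContRepresentation.ClosedSubrep.mem_fixedVectors] at hx
    exact h _ 𝔪 h𝔪 le_rfl x hx0 hx
  intro N
  induction N with
  | zero =>
    intro 𝔪 h𝔪 hcard x hx0 hx
    refine ⟨𝔪, h𝔪, fun v hv => ?_, x, hx0, hx⟩
    by_contra hvS
    have hmem : v ∈ (Ideal.finite_factors h𝔪).toFinset.filter (· ∉ S) :=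
      Finset.mem_filter.2 ⟨(Ideal.finite_factors h𝔪).mem_toFinset.2 hv, hvS⟩
    rw [Nat.le_zero, Finset.card_eq_zero] at hcard
    rw [hcard] at hmem
    exact Finset.notMem_empty v hmem
  | succ N ih =>
    intro 𝔪 h𝔪 hcard x hx0 hx
    by_cases hempty : (Ideal.finite_factors h𝔪).toFinset.filter (· ∉ S) = ∅
    · refine ⟨𝔪, h𝔪, fun v hv => ?_, x, hx0, hx⟩
      by_contra hvS
      have hmem : v ∈ (Ideal.finite_factors h𝔪).toFinset.filter (· ∉ S) :=
        Finset.mem_filter.2 ⟨(Ideal.finite_factors h𝔪).mem_toFinset.2 hv, hvS⟩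
      rw [hempty] at hmem
      exact Finset.notMem_empty v hmem
    -- a prime `w ∣ 𝔪` outside `S`; `𝔪 = 𝔭_w^e 𝔪'` with `w ∤ 𝔪'`
    obtain ⟨w, hwmem⟩ := Finset.nonempty_iff_ne_empty.2 hempty
    obtain ⟨-, hwS⟩ := Finset.mem_filter.1 hwmem
    obtain ⟨e, 𝔪', hw𝔪', h𝔪eq⟩ := WfDvdMonoid.max_power_factor h𝔪 w.irreducible
    have h𝔪' : 𝔪' ≠ 0 := by
      rintro rfl
      rw [mul_zero] at h𝔪eq
      exact h𝔪 h𝔪eq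
    rw [h𝔪eq] at hx
    obtain ⟨y, hy0, hy⟩ := exists_level_of_level_pow_mul P (hS w hwS) h𝔪' hw𝔪' e hx0 hx
    -- the primes of `𝔪'` outside `S` are among those of `𝔪` outside `S`, and `w` is not one of them
    refine ih 𝔪' h𝔪' ?_ y hy0 hy
    have hsub : (Ideal.finite_factors h𝔪').toFinset.filter (· ∉ S) ⊂ (Ideal.finite_factors h𝔪).toFinset.filter (· ∉ S) := by
      rw [Finset.ssubset_iff_of_subset]
      · exact ⟨w, hwmem, fun h => hw𝔪' ((Ideal.finite_factors h𝔪').mem_toFinset.1 (Finset.mem_filter.1 h).1)⟩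
      · intro v hv
        obtain ⟨hv𝔪', hvS⟩ := Finset.mem_filter.1 hv
        refine Finset.mem_filter.2 ⟨(Ideal.finite_factors h𝔪).mem_toFinset.2 ?_, hvS⟩
        rw [h𝔪eq]
        exact Dvd.dvd.mul_left ((Ideal.finite_factors h𝔪').mem_toFinset.1 hv𝔪') _
    have hlt := Finset.card_lt_card hsub
    omega

/-- The same, with the conclusion phrased through `fixedVectors`. [cite: FlathCorvallis1979, Thm. 3] -/
theorem CuspidalAutomorphicRepGL.exists_fixedVectors_level_supportedIn' (P : CuspidalAutomorphicRepGL n K μ)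
    (S : Set (HeightOneSpectrum (𝓞 K))) (hS : ∀ v ∉ S, IsUnramifiedAt P.1 v) :
    ∃ 𝔫 : Ideal (𝓞 K), 𝔫 ≠ 0 ∧ (∀ v : HeightOneSpectrum (𝓞 K), v.asIdeal ∣ 𝔫 → v ∈ S) ∧
      ∃ f ∈ P.1.fixedVectors (principalCongruenceLevel n K 𝔫), f ≠ 0 := by
  obtain ⟨𝔫, h𝔫, hsupp, f, hf0, hf⟩ := P.exists_fixedVectors_level_supportedIn S hS
  exact ⟨𝔫, h𝔫, hsupp, f, (ContRepresentation.ClosedSubrep.mem_fixedVectors _ _ _).2 hf, hf0⟩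

/-- **For a Satake family off `S`**: a cuspidal `Π` with a Satake family away from `S` has a non-zero
vector of a level `K(𝔫)`, `𝔫 ≠ 0`, supported on `S`. [cite: FlathCorvallis1979, Thm. 3] -/
theorem IsSatakeFamilyOf.exists_fixedVectors_level_supportedIn {P : CuspidalAutomorphicRepGL n K μ}
    {S : Set (HeightOneSpectrum (𝓞 K))} {α : SatakeFamily K} (hα : IsSatakeFamilyOf P S α) :
    ∃ 𝔫 : Ideal (𝓞 K), 𝔫 ≠ 0 ∧ (∀ v : HeightOneSpectrum (𝓞 K), v.asIdeal ∣ 𝔫 → v ∈ S) ∧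
      ∃ f : P.1.toSubmodule, f ≠ 0 ∧ ∀ u ∈ principalCongruenceLevel n K 𝔫, P.1.toContRep u f = f :=
  P.exists_fixedVectors_level_supportedIn S fun _ hv => hα.isUnramifiedAt hv

end Level

end Literature.NumberTheory.Automorphic
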